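import Summits.PneNP.PneNP.Theorems.SoloInformedIOShape
import Literature.Computability.MetaComplexity.McKayMurrayWilliams2019.UniformStreamingProofs
import HarnessLib

/-!
# Solo (informed) — the magnification door: a `poly(s)` uniform streaming lower bound for `MCSP[s]` gives `PneNP`

Summit-side corollaries of the Literature proof
`Literature/Computability/MetaComplexity/McKayMurrayWilliams2019/UniformStreamingProofs.lean`
(McKay–Murray–Williams 2019, Thm. 1.3, proved there for polynomially honest size functions):

* `soloInformed_pneNP_of_streamingLowerBound` — for any `s` computable in polynomial time from
  unary to unary with `n ≤ s n`: if `MCSP[s]` has, for every `c`, no uniform one-pass streaming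
  algorithm with space and update/report time `s(log₂ N)^c + c`, then `PneNP`;
* `soloInformed_pneNP_of_streamingLowerBound_pow` — the case `s(n) = n^k`, `k ≥ 1`;
* `soloInformed_mcspSize_mem_USTREAM_of_not_pneNP` — the constructive content: if `¬ PneNP` then
  every such `MCSP[s]` IS decided by a uniform streaming algorithm with `poly(s(log₂ N))` space and
  update time (so the door is exactly as wide as the lower bound it asks for).

Place in the solo programme's *sharpest statement* (`paper/sharpest-statement.md`, §4 "doors"):
this is the one door in the portfolio whose hypothesis is a lower bound against a SUB-LINEAR-state,
uniform, one-pass model — `s(log₂ N)^c + c = polylog(N)^{O(1)}` bits of memory on a stream of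
`N` bits — rather than against general polynomial time.  What a proof through it must do: fix
`k ≥ 1` and show, for every constant `c`, that no single `TM2` update machine running in
`(k log₂ N)^{c} + c` steps per bit on states of that length decides `MCSP[n^k]`.  The locality
barrier (Chen–Hirahara–Oliveira–Pich–Rajgopal–Santhanam 2020, arXiv:1911.08297) is the recorded
reason such bounds are not in reach of known streaming lower-bound techniques: those techniques
also apply to problems that DO have small-space streaming algorithms with a local oracle, which
`MCSP[n^k]` has.
-/

namespace Summit.PneNP.PneNP.Theorems

open Literature.Computability.Complexity Literature.Computability.MetaComplexity
open Literature.Computability.MetaComplexity.McKayMurrayWilliams2019 CodeFP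

/-- **The magnification door (MMW19 Thm. 1.3, polynomially honest `s`).** If `s` is polynomial-time
computable from unary to unary, `n ≤ s n`, and `MCSP[s]` has no uniform `poly(s(log₂ N))`-space,
`poly(s(log₂ N))`-update-time one-pass streaming algorithm, then `P ≠ NP` (as the summit statement
`PneNP`). [cite: McKayMurrayWilliams2019, Thm. 1.3] -/
theorem soloInformed_pneNP_of_streamingLowerBound {s : ℕ → ℕ} (hs : CodeFP unE unE s)
    (hsn : ∀ n, n ≤ s n) (h : StreamingLowerBound s) : PneNP :=
  soloInformed_pneNP_iff_exists_not_mem.2 (Classical.by_contradiction fun hne =>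
    not_NP_subset_P_of_streamingLowerBound_of_codeFP hs hsn h fun L hL =>
      Classical.by_contradiction fun hLP => hne ⟨L, hL, hLP⟩)

/-- **The door for `s(n) = n^k`, `k ≥ 1`.** A uniform streaming lower bound for `MCSP[n^k]`
against space and update time `(k·log₂ N)^{c} + c` for every `c` implies `PneNP`.
[cite: McKayMurrayWilliams2019, Thm. 1.3] -/
theorem soloInformed_pneNP_of_streamingLowerBound_pow (k : ℕ) (hk : 1 ≤ k)
    (h : StreamingLowerBound (fun n => n ^ k)) : PneNP :=
  soloInformed_pneNP_of_streamingLowerBound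
    (s := fun n => n ^ k) (((ulength unitE).comp (unitsPow k)).congr fun n => by simp)
    (fun n => Nat.le_self_pow (by omega) n) h

/-- **Width of the door.** Conversely to the way the door is used: if `¬ PneNP` (i.e. `P = NP`)
then for every polynomially honest `s`, `MCSP[s]` is decided by a uniform one-pass streaming
algorithm with space and update/report time `s(log₂ N)^c + c` for some `c` — so the hypothesis
`StreamingLowerBound s` is not merely sufficient but forced by `PneNP` being provable this way.
[cite: McKayMurrayWilliams2019, Thm. 1.2] -/
theorem soloInformed_mcspSize_mem_USTREAM_of_not_pneNP (hP : ¬ PneNP) {s : ℕ → ℕ}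
    (hs : CodeFP unE unE s) (hsn : ∀ n, n ≤ s n) :
    ∃ c : ℕ, MCSPSize s ∈
      USTREAM (fun N => s (Nat.log 2 N) ^ c + c) (fun N => s (Nat.log 2 N) ^ c + c) := by
  refine MCSPSize_mem_USTREAM_of_NP_subset_P (fun L hL => ?_) hs hsn
  by_contra hLP
  exact hP (soloInformed_pneNP_iff_exists_not_mem.2 ⟨L, hL, hLP⟩)

end Summit.PneNP.PneNP.Theorems
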